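import Literature.Computability.AlgebraicComplexity.DDS21DepthThreeDiagonalToolkit
import HarnessLib

/-!
# DDS21 §2.3 / §5: the class `Σ∧Σ∧` (sums of powers of sums of univariates) with budgets

Definition companion (cell `val-lit`, brick **B6-0** of the sizing memo
`HOME/np/MEMO-p1g10-DDS21-B6-Thm51-sizing.md` for the named fact `DDS2021_thm_5_1`, which stays
OPEN by name) of `DDS21BorderDepthThree.lean` (classes `swsClass` = `Σ∧Σ`, `spswClass` =
`Σ^{[k]}ΠΣ∧`) and of the `Σ∧Σ` toolkit `DDS21DepthThreeDiagonalToolkit.lean` (B2). Source: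
P. Dutta, P. Dwivedi, N. Saxena, *Demystifying the border of depth-3 algebraic circuits*, FOCS 2021,
FULL VERSION (`paper:galaxy-pdf-7641649743695546420`, printed line numbers `Lnnn`): §2.3
(p0020 L537 – p0022 L603: "The above lemma, and its proof, hold good for the more general `Σ∧Σ∧`
circuits" L556–557; "The above holds for `Σ∧Σ∧/Σ∧Σ∧` circuits as well" L568; "Same property holds
for `Σ∧Σ∧` circuits" L584; Lemma 2.17 "`Σ∧Σ∧` as ARO … Let `g^e = (g_1(x_1) + ⋯ + g_n(x_n))^e`,
where `deg(g_i) · e ≤ D`" L595–601) and §5, Thm. 5.1 proof sketch (p0043 L1151 – p0045 L1: the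
bloated model `(ΠΣ∧/ΠΣ∧)·(Σ∧Σ∧/Σ∧Σ∧)`, Claim 5.2) [DuttaDwivediSaxena2022].

THE OBJECT. A `Σ∧Σ∧` circuit computes `f = ∑_{i<t} c_i · g_i^{e_i}` where each `g_i` is computed by
the bottom `Σ∧` part, i.e. is a sum of univariate monomials — a constant plus a sum of univariate
polynomials, `g = a + ∑_{m<n} p_m(x_m)` (`wedgeForm a p`; the constant is a separate datum exactly
as in the tree's `spswClass`, whose product gates multiply such forms). `swswClass K n t e δ` is the
SET of `n`-variate polynomials over `K` so computed with top fan-in `≤ t`, exponents `e_i ≤ e` and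
univariate degrees `deg p_{im} ≤ δ` (pad with zero terms, so "`≤`" throughout).

SIZE CONVENTION. The printed size of `∑_{i<t} c_i g_i^{e_i}` is `Θ(∑_i e_i · size(g_i))` with
`size(g_i) = Θ(∑_m (deg p_{im} + 1))`, so `t ≤ size ≤ t · e · n · (δ + 1)` (up to the constant);
as in B2, every lemma books the budget triple `(t, e, δ)` explicitly, from which the printed
`O(·)` / "syntactic degree `D ≥ e · δ`" bounds follow.

## Contents (definitions with bodies; every statement PROVED; no named facts)

* §1 `wedgeForm a p := C a + ∑_m aeval (X m) (p m)` with `wedgeForm_eq`,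
  `totalDegree_wedgeForm_le` (`≤ δ`), `affine_eq_wedgeForm` (an affine form is the `Σ∧` form with
  linear univariates), `wedgeForm_zero_single` (a lone univariate).
* §2 `swswClass K n t e δ` (the class `Σ∧Σ∧(t, e, δ)`).
* §3 folklore API, each a few lines from the definition (the `Σ∧Σ` versions are B2's
  `mem_swsClass_of_fintype`, `swsClass_mono`, …): re-indexing over any finite index type
  `mem_swswClass_of_fintype`, `swswClass_mono`, `zero/C/X/aeval_X/C_mul_wedgePow/wedgePow_mem`,
  **`swsClass_subset_swswClass`** (`Σ∧Σ(t,e) ⊆ Σ∧Σ∧(t,e,1)`), `totalDegree_le_of_mem_swswClass`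
  (`≤ e·δ`), and the additive closure used tacitly in §2.3/§5 (`C_mul/neg/add/add'/sub/sum/
  sum_univ_mem_swswClass`; fan-ins add, the other two budgets take the maximum).
* §4 extension of scalars (`map_aeval_X`, `map_wedgeForm`, `swswClass_map`: a field hom
  `φ : K →+* L` maps `Σ∧Σ∧(t,e,δ)` over `K` into `Σ∧Σ∧(t,e,δ)` over `L`) and
  `mem_border_swswClass` (exact members are border members, `border` of
  `DDS21BorderDepthThree`). (§3–§4 incorporate the rc-0 draft val-lit p1 g10 banked for this file,
  `HOME/np/p1g10-DDS21WedgeWedgeClass.DRAFT-for-t20.lean.txt`, same statements.)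

Not here (brick B6-1, theorem-only sibling `DDS21WedgeWedgeToolkit.lean`): the multiplicative
closure (Lemma 2.12 Remark, via B2's `exists_waringWeights_two`), derivatives (Lemma 2.15 Remark),
shifts `x ↦ x + α`, homogeneous components (Lemma 2.14 by interpolation on the dilation
`g(ζ·x)`), and the duality link to sums of products of univariates (Lemma 2.17 → B2b's
de-bordering, brick B6-2).

Deviations from print, disclosed: (i) budgets `(t, e, δ)` instead of the single printed size
`s` (SIZE CONVENTION above); (ii) the constant of a `Σ∧` form is an explicit datum `a` (print folds
it into the univariates; with `a` separate the class is literally the set of sums of powers of the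
inner forms of `spswClass`, and `n = 0` needs no case split); (iii) coefficients in a FIELD `K`
(the source's §5 runs the calculus over `𝔽(ε)` and the rings `R_j`; as for B2, representation-level
identities serve those, the set-level class is over a field).

Honest framing: a definition and its bookkeeping for a restricted circuit class, banked toward
the x-row `DDS2021_thm_5_1`; it discharges nothing by itself; `VP ≠ VNP` is NOT proved and nothing
here bears on it.

## References

* [DuttaDwivediSaxena2022] P. Dutta, P. Dwivedi, N. Saxena, *Demystifying the border of depth-3
  algebraic circuits*, Proc. 62nd FOCS (2021), IEEE 2022, 92–103; full version §2.3 (p0020 L537 –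
  p0022 L603, esp. the `Σ∧Σ∧` remarks L556–557, L568, L584 and Lemma 2.17 L593–603) and §5,
  Thm. 5.1 with Claim 5.2 (p0043 L1144 – p0045 L1).
-/

noncomputable section

open MvPolynomial
open scoped BigOperators

namespace Literature.Computability.AlgebraicComplexity

namespace DDS2021

/-! ## §1 `Σ∧` forms: a constant plus a sum of univariates -/

section WedgeForm

variable {K : Type*} [Field K] {n : ℕ}

/-- A **`Σ∧` form** (the bottom `Σ∧` of `Σ∧Σ∧` and of `ΠΣ∧`): a constant plus a sum of univariate
polynomials, `a + ∑_{m<n} p_m(x_m)` — the `g = g_1(x_1) + ⋯ + g_n(x_n)` of the proof of Lemma 2.17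
(the constant is kept as a separate datum, as in the tree's `spswClass`, so that `n = 0` is not
special). [cite: DuttaDwivediSaxena2022, Lemma 2.17 proof (full version p0022 L597–601); §5 Thm. 5.1 (p0043 L1153)] -/
def wedgeForm (a : K) (p : Fin n → Polynomial K) : MvPolynomial (Fin n) K :=
  C a + ∑ m, Polynomial.aeval (X m : MvPolynomial (Fin n) K) (p m)

/-- Unfolding `wedgeForm`. [cite: DuttaDwivediSaxena2022, Lemma 2.17 proof (full version p0022 L597–601)] -/
theorem wedgeForm_eq (a : K) (p : Fin n → Polynomial K) :
    wedgeForm a p = C a + ∑ m, Polynomial.aeval (X m : MvPolynomial (Fin n) K) (p m) := rfl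

/-- A `Σ∧` form with univariates of degree `≤ δ` has total degree `≤ δ`
("`deg(g_i) · e ≤ D`", p0022 L597). [cite: DuttaDwivediSaxena2022, Lemma 2.17 proof (full version p0022 L597–601)] -/
theorem totalDegree_wedgeForm_le {δ : ℕ} (a : K) {p : Fin n → Polynomial K}
    (hp : ∀ m, (p m).natDegree ≤ δ) : (wedgeForm a p).totalDegree ≤ δ := by
  rw [wedgeForm_eq]
  refine (totalDegree_add _ _).trans (max_le (by rw [totalDegree_C]; exact Nat.zero_le _) ?_)
  exact totalDegree_finsetSum_le fun m _ => totalDegree_aeval_X_le m (hp m)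

/-- An affine form `a_∅ + ∑_m a_m x_m` is the `Σ∧` form with the linear univariates `a_m · X`
(so `Σ∧Σ ⊆ Σ∧Σ∧`). [cite: DuttaDwivediSaxena2022, §2.3 (full version p0020 L537–540, p0022 L593–596)] -/
theorem affine_eq_wedgeForm (α : Option (Fin n) → K) :
    (C (α none) + ∑ m, C (α (some m)) * X m : MvPolynomial (Fin n) K) =
      wedgeForm (α none) (fun m => Polynomial.C (α (some m)) * Polynomial.X) := by
  rw [wedgeForm_eq]
  congr 1
  refine Finset.sum_congr rfl fun m _ => ?_
  rw [map_mul, Polynomial.aeval_C, Polynomial.aeval_X, algebraMap_eq]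

/-- The linear univariate `a · X` has degree `≤ 1`. [folklore] -/
private theorem natDegree_C_mul_X_le_one (a : K) : (Polynomial.C a * Polynomial.X).natDegree ≤ 1 :=
  (Polynomial.natDegree_C_mul_le _ _).trans Polynomial.natDegree_X_le

/-- A single univariate `q(x_m)` is the `Σ∧` form with constant `0` and the univariates
`(0, …, q, …, 0)`. [cite: DuttaDwivediSaxena2022, Lemma 2.17 proof (full version p0022 L597–601)] -/
theorem wedgeForm_zero_single (m : Fin n) (q : Polynomial K) :
    wedgeForm (0 : K) (Pi.single m q) = Polynomial.aeval (X m : MvPolynomial (Fin n) K) q := by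
  classical
  rw [wedgeForm_eq, C_0, zero_add, Finset.sum_eq_single m]
  · rw [Pi.single_eq_same]
  · intro j _ hj
    rw [Pi.single_eq_of_ne hj, map_zero]
  · intro hm
    exact absurd (Finset.mem_univ m) hm

end WedgeForm

/-! ## §2 The class `Σ∧Σ∧(t, e, δ)` -/

section Classes

variable (K : Type*) [Field K] (n : ℕ)

/-- **`Σ∧Σ∧` (sums of powers of sums of univariates)** with top fan-in `≤ t`, exponents `≤ e` and
bottom (univariate) degrees `≤ δ`: `f = ∑_{i<t} c_i · (a_i + ∑_m p_{im}(x_m))^{e_i}`, `e_i ≤ e`,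
`deg p_{im} ≤ δ` — the "more general model `Σ∧Σ∧`" of §2.3 (Lemma 2.17: "`g^e = (g_1(x_1) + ⋯ +
g_n(x_n))^e` … we do this for each power (i.e. each summand of `f`)") and the `Σ∧Σ∧` of the bloated
model `(ΠΣ∧/ΠΣ∧)·(Σ∧Σ∧/Σ∧Σ∧)` of §5. The printed size of such a circuit is
`Θ(∑_i e_i · ∑_m (deg p_{im} + 1))`; as for the tree's `swsClass`, the triple `(t, e, δ)` is booked
instead (SIZE CONVENTION of the module docstring). The inner forms are those of the tree's
`spswClass` (`Σ^{[k]}ΠΣ∧`).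
[cite: DuttaDwivediSaxena2022, Lemma 2.17 (full version p0022 L593–603); §5 Thm. 5.1 proof sketch (p0043 L1151 – p0044 L1164)] -/
def swswClass (t e δ : ℕ) : Set (MvPolynomial (Fin n) K) :=
  {f | ∃ (c a : Fin t → K) (p : Fin t → Fin n → Polynomial K) (ex : Fin t → ℕ),
    (∀ i, ex i ≤ e) ∧ (∀ i m, (p i m).natDegree ≤ δ) ∧
      f = ∑ i, C (c i) * wedgeForm (a i) (p i) ^ ex i}

end Classes

/-! ## §3 Folklore API of `Σ∧Σ∧(t, e, δ)`: re-indexing, monotonicity, generators, degree -/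

section API

variable {K : Type*} [Field K] {n : ℕ}

/-- **Re-indexing**: a sum of `c_i · g_i^{e_i}` (`g_i` a `Σ∧` form with univariates of degree
`≤ δ`, `e_i ≤ e`) over ANY finite index type with at most `t` elements is in `Σ∧Σ∧(t, e, δ)` (pad
with zero coefficients along an embedding into `Fin t`).
[cite: DuttaDwivediSaxena2022, Lemma 2.17 (full version p0022 L593–603)] -/
theorem mem_swswClass_of_fintype {ι : Type*} [Fintype ι] {t e δ : ℕ} (hι : Fintype.card ι ≤ t)
    (c a : ι → K) (p : ι → Fin n → Polynomial K) (ex : ι → ℕ) (hex : ∀ i, ex i ≤ e)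
    (hp : ∀ i m, (p i m).natDegree ≤ δ) {f : MvPolynomial (Fin n) K}
    (hf : f = ∑ i, C (c i) * wedgeForm (a i) (p i) ^ ex i) :
    f ∈ swswClass K n t e δ := by
  classical
  have hcard : Fintype.card ι ≤ Fintype.card (Fin t) := by rwa [Fintype.card_fin]
  obtain ⟨φ⟩ := Function.Embedding.nonempty_of_card_le hcard
  refine ⟨Function.extend φ c 0, Function.extend φ a 0, Function.extend φ p 0,
    Function.extend φ ex 0, ?_, ?_, ?_⟩
  · intro j
    by_cases hj : ∃ i, φ i = j
    · obtain ⟨i, rfl⟩ := hj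
      rw [φ.injective.extend_apply]
      exact hex i
    · rw [Function.extend_apply' _ _ _ hj]
      exact Nat.zero_le _
  · intro j m
    by_cases hj : ∃ i, φ i = j
    · obtain ⟨i, rfl⟩ := hj
      rw [φ.injective.extend_apply]
      exact hp i m
    · rw [Function.extend_apply' _ _ _ hj]
      simp
  · rw [hf]
    -- the sum over `Fin t` is supported on the image of `φ`
    have hsupp : ∀ j ∈ (Finset.univ : Finset (Fin t)), j ∉ Finset.univ.map φ →
        C (Function.extend φ c 0 j) *
          wedgeForm (Function.extend φ a 0 j) (Function.extend φ p 0 j) ^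
            Function.extend φ ex 0 j = 0 := by
      intro j _ hj
      have hj' : ¬ ∃ i, φ i = j := by
        rintro ⟨i, rfl⟩
        exact hj (Finset.mem_map_of_mem φ (Finset.mem_univ i))
      rw [Function.extend_apply' _ _ _ hj', Pi.zero_apply, C_0, zero_mul]
    rw [← Finset.sum_subset (Finset.subset_univ (Finset.univ.map φ)) hsupp, Finset.sum_map]
    refine Finset.sum_congr rfl fun i _ => ?_
    simp only [φ.injective.extend_apply]

/-- **Monotonicity** of the three budgets. [cite: DuttaDwivediSaxena2022, Lemma 2.17 (full version p0022 L593–603)] -/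
theorem swswClass_mono {t t' e e' δ δ' : ℕ} (ht : t ≤ t') (he : e ≤ e') (hδ : δ ≤ δ') :
    swswClass K n t e δ ⊆ swswClass K n t' e' δ' := by
  rintro f ⟨c, a, p, ex, hex, hp, hf⟩
  exact mem_swswClass_of_fintype (by rwa [Fintype.card_fin]) c a p ex (fun i => (hex i).trans he)
    (fun i m => (hp i m).trans hδ) hf

/-- `0 ∈ Σ∧Σ∧(t, e, δ)` (the empty circuit). [cite: DuttaDwivediSaxena2022, Lemma 2.17 (full version p0022 L593–603)] -/
theorem zero_mem_swswClass (t e δ : ℕ) : (0 : MvPolynomial (Fin n) K) ∈ swswClass K n t e δ :=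
  mem_swswClass_of_fintype (ι := Fin 0) (by simp) (fun _ => 0) (fun _ => 0) (fun _ _ => 0)
    (fun _ => 0) (fun _ => Nat.zero_le _) (fun _ _ => by simp) (by simp)

/-- A scalar multiple of one power of a `Σ∧` form, `c · g^k` with `k ≤ e` and univariates of
degree `≤ δ`, is in `Σ∧Σ∧(t, e, δ)` for every `t ≥ 1`.
[cite: DuttaDwivediSaxena2022, Lemma 2.17 (full version p0022 L593–603)] -/
theorem C_mul_wedgePow_mem_swswClass {t e δ k : ℕ} (ht : 1 ≤ t) (hk : k ≤ e) (c a : K)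
    {p : Fin n → Polynomial K} (hp : ∀ m, (p m).natDegree ≤ δ) :
    C c * wedgeForm a p ^ k ∈ swswClass K n t e δ :=
  mem_swswClass_of_fintype (ι := Fin 1) (by simpa using ht) (fun _ => c) (fun _ => a) (fun _ => p)
    (fun _ => k) (fun _ => hk) (fun _ m => hp m) (by simp)

/-- A power of a `Σ∧` form `g^k`, `k ≤ e`, is in `Σ∧Σ∧(t, e, δ)` for `t ≥ 1`.
[cite: DuttaDwivediSaxena2022, Lemma 2.17 (full version p0022 L593–603)] -/
theorem wedgePow_mem_swswClass {t e δ k : ℕ} (ht : 1 ≤ t) (hk : k ≤ e) (a : K)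
    {p : Fin n → Polynomial K} (hp : ∀ m, (p m).natDegree ≤ δ) :
    wedgeForm a p ^ k ∈ swswClass K n t e δ := by
  have h := C_mul_wedgePow_mem_swswClass ht hk (1 : K) a hp
  rwa [C_1, one_mul] at h

/-- Constants are in `Σ∧Σ∧(t, e, δ)` for `t ≥ 1` (`c = c · g^0`).
[cite: DuttaDwivediSaxena2022, Lemma 2.17 (full version p0022 L593–603)] -/
theorem C_mem_swswClass {t e δ : ℕ} (ht : 1 ≤ t) (c : K) :
    (C c : MvPolynomial (Fin n) K) ∈ swswClass K n t e δ := by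
  have h := C_mul_wedgePow_mem_swswClass (δ := δ) (k := 0) ht (Nat.zero_le e) c (0 : K)
    (p := fun _ : Fin n => (0 : Polynomial K)) (fun _ => by simp)
  rwa [pow_zero, mul_one] at h

/-- A single univariate `q(x_m)` of degree `≤ δ` is in `Σ∧Σ∧(t, e, δ)` for `t, e ≥ 1`
(`q(x_m) = (0 + q(x_m))^1`). [cite: DuttaDwivediSaxena2022, Lemma 2.17 (full version p0022 L593–603)] -/
theorem aeval_X_mem_swswClass {t e δ : ℕ} (ht : 1 ≤ t) (he : 1 ≤ e) (m : Fin n)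
    {q : Polynomial K} (hq : q.natDegree ≤ δ) :
    Polynomial.aeval (X m : MvPolynomial (Fin n) K) q ∈ swswClass K n t e δ := by
  classical
  have hp : ∀ j, (Pi.single (M := fun _ : Fin n => Polynomial K) m q j).natDegree ≤ δ := by
    intro j
    by_cases hj : j = m
    · subst hj; rwa [Pi.single_eq_same]
    · rw [Pi.single_eq_of_ne hj, Polynomial.natDegree_zero]; exact Nat.zero_le _
  have h := wedgePow_mem_swswClass (k := 1) ht he (0 : K) hp
  rwa [pow_one, wedgeForm_zero_single] at h

/-- A variable is in `Σ∧Σ∧(t, e, δ)` for `t, e, δ ≥ 1`.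
[cite: DuttaDwivediSaxena2022, Lemma 2.17 (full version p0022 L593–603)] -/
theorem X_mem_swswClass {t e δ : ℕ} (ht : 1 ≤ t) (he : 1 ≤ e) (hδ : 1 ≤ δ) (m : Fin n) :
    (X m : MvPolynomial (Fin n) K) ∈ swswClass K n t e δ := by
  have h := aeval_X_mem_swswClass (K := K) ht he m (q := Polynomial.X)
    (Polynomial.natDegree_X_le.trans hδ)
  rwa [Polynomial.aeval_X] at h

/-- **`Σ∧Σ ⊆ Σ∧Σ∧`**: a depth-3 diagonal circuit is a `Σ∧Σ∧` circuit with linear univariates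
(`δ = 1`), same top fan-in and exponents ("we give the proof for a more general model `Σ∧Σ∧`",
p0022 L594–595). [cite: DuttaDwivediSaxena2022, Lemma 2.17 (full version p0022 L593–596)] -/
theorem swsClass_subset_swswClass (t e : ℕ) : swsClass K n t e ⊆ swswClass K n t e 1 := by
  rintro f ⟨c, α, ex, hex, rfl⟩
  refine mem_swswClass_of_fintype (ι := Fin t) (by simp) c (fun i => α i none)
    (fun i m => Polynomial.C (α i (some m)) * Polynomial.X) ex hex
    (fun i m => natDegree_C_mul_X_le_one _) ?_
  refine Finset.sum_congr rfl fun i _ => ?_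
  rw [affine_eq_wedgeForm]

/-- **Syntactic degree bound**: every member of `Σ∧Σ∧(t, e, δ)` has total degree `≤ e · δ`
("syntactic degree `D`", "`deg(g_i) · e ≤ D`", p0022 L596–597).
[cite: DuttaDwivediSaxena2022, Lemma 2.17 (full version p0022 L593–601)] -/
theorem totalDegree_le_of_mem_swswClass {t e δ : ℕ} {f : MvPolynomial (Fin n) K}
    (hf : f ∈ swswClass K n t e δ) : f.totalDegree ≤ e * δ := by
  obtain ⟨c, a, p, ex, hex, hp, rfl⟩ := hf
  refine totalDegree_finsetSum_le fun i _ => (totalDegree_mul _ _).trans ?_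
  rw [totalDegree_C, zero_add]
  refine (totalDegree_pow _ _).trans ?_
  exact Nat.mul_le_mul (hex i) (totalDegree_wedgeForm_le (a i) (hp i))

/-- **Scalars**: `c · f ∈ Σ∧Σ∧(t, e, δ)` whenever `f ∈ Σ∧Σ∧(t, e, δ)`.
[cite: DuttaDwivediSaxena2022, Lemma 2.12 Remark (full version p0020 L556–557)] -/
theorem C_mul_mem_swswClass {t e δ : ℕ} (c : K) {f : MvPolynomial (Fin n) K}
    (hf : f ∈ swswClass K n t e δ) : C c * f ∈ swswClass K n t e δ := by
  obtain ⟨c', a, p, ex, hex, hp, hf⟩ := hf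
  refine ⟨fun i => c * c' i, a, p, ex, hex, hp, ?_⟩
  rw [hf, Finset.mul_sum]
  refine Finset.sum_congr rfl fun i _ => ?_
  rw [C_mul, mul_assoc]

/-- **Negation**. [cite: DuttaDwivediSaxena2022, Lemma 2.12 Remark (full version p0020 L556–557)] -/
theorem neg_mem_swswClass {t e δ : ℕ} {f : MvPolynomial (Fin n) K}
    (hf : f ∈ swswClass K n t e δ) : -f ∈ swswClass K n t e δ := by
  have h := C_mul_mem_swswClass (-1 : K) hf
  rwa [C_neg, C_1, neg_one_mul] at h

/-- **Addition**: fan-ins add, exponent and bottom-degree bounds take the maximum ("Trivially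
… closed under addition", p0021 L566; "holds for `Σ∧Σ∧` … as well", L568).
[cite: DuttaDwivediSaxena2022, Lemma 2.13 and Remark (full version p0021 L560–568)] -/
theorem add_mem_swswClass {t₁ t₂ e₁ e₂ δ₁ δ₂ : ℕ} {f g : MvPolynomial (Fin n) K}
    (hf : f ∈ swswClass K n t₁ e₁ δ₁) (hg : g ∈ swswClass K n t₂ e₂ δ₂) :
    f + g ∈ swswClass K n (t₁ + t₂) (max e₁ e₂) (max δ₁ δ₂) := by
  obtain ⟨c, a, p, ex, hex, hp, hf⟩ := hf
  obtain ⟨c', a', p', ex', hex', hp', hg⟩ := hg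
  refine mem_swswClass_of_fintype (ι := Fin t₁ ⊕ Fin t₂) (by simp) (Sum.elim c c')
    (Sum.elim a a') (Sum.elim p p') (Sum.elim ex ex') ?_ ?_ ?_
  · rintro (i | i)
    · exact (hex i).trans (le_max_left _ _)
    · exact (hex' i).trans (le_max_right _ _)
  · rintro (i | i) m
    · exact (hp i m).trans (le_max_left _ _)
    · exact (hp' i m).trans (le_max_right _ _)
  · rw [hf, hg, Fintype.sum_sum_type]
    simp only [Sum.elim_inl, Sum.elim_inr]

/-- **Addition**, same budgets. [cite: DuttaDwivediSaxena2022, Lemma 2.13 and Remark (full version p0021 L560–568)] -/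
theorem add_mem_swswClass' {t₁ t₂ e δ : ℕ} {f g : MvPolynomial (Fin n) K}
    (hf : f ∈ swswClass K n t₁ e δ) (hg : g ∈ swswClass K n t₂ e δ) :
    f + g ∈ swswClass K n (t₁ + t₂) e δ := by
  have h := add_mem_swswClass hf hg
  rwa [max_self, max_self] at h

/-- **Subtraction**. [cite: DuttaDwivediSaxena2022, Lemma 2.13 and Remark (full version p0021 L560–568)] -/
theorem sub_mem_swswClass {t₁ t₂ e δ : ℕ} {f g : MvPolynomial (Fin n) K}
    (hf : f ∈ swswClass K n t₁ e δ) (hg : g ∈ swswClass K n t₂ e δ) :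
    f - g ∈ swswClass K n (t₁ + t₂) e δ := by
  rw [sub_eq_add_neg]
  exact add_mem_swswClass' hf (neg_mem_swswClass hg)

/-- **Finite sums**: `∑_{i ∈ s} f_i ∈ Σ∧Σ∧(#s · t, e, δ)` when every `f_i ∈ Σ∧Σ∧(t, e, δ)`.
[cite: DuttaDwivediSaxena2022, Lemma 2.13 and Remark (full version p0021 L560–568)] -/
theorem sum_mem_swswClass {ι : Type*} {t e δ : ℕ} (s : Finset ι)
    (f : ι → MvPolynomial (Fin n) K) (hf : ∀ i ∈ s, f i ∈ swswClass K n t e δ) :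
    ∑ i ∈ s, f i ∈ swswClass K n (s.card * t) e δ := by
  classical
  induction s using Finset.induction_on with
  | empty => simpa using zero_mem_swswClass (n := n) (K := K) 0 e δ
  | @insert b s hb ih =>
    rw [Finset.sum_insert hb, Finset.card_insert_of_notMem hb, add_mul, one_mul,
      add_comm (s.card * t)]
    exact add_mem_swswClass' (hf b (Finset.mem_insert_self b s))
      (ih fun i hi => hf i (Finset.mem_insert_of_mem hi))

/-- **Finite sums over a `Fintype`**. [cite: DuttaDwivediSaxena2022, Lemma 2.13 and Remark (full version p0021 L560–568)] -/
theorem sum_univ_mem_swswClass {ι : Type*} [Fintype ι] {t e δ : ℕ}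
    (f : ι → MvPolynomial (Fin n) K) (hf : ∀ i, f i ∈ swswClass K n t e δ) :
    ∑ i, f i ∈ swswClass K n (Fintype.card ι * t) e δ :=
  sum_mem_swswClass Finset.univ f fun i _ => hf i

end API

/-! ## §4 Extension of scalars; exact members are border members -/

section Scalars

variable {K : Type*} [Field K] {n : ℕ}

/-- Extension of scalars on a univariate in `x_m`: `map φ (q(x_m)) = (q^φ)(x_m)` (reading a
circuit over a larger field, Def. 2.1's `𝒞_{𝔽(ε)}`). [cite: DuttaDwivediSaxena2022, Def. 2.1 (full version p0016 L416–419)] -/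
theorem map_aeval_X {L : Type*} [Field L] (φ : K →+* L) (m : Fin n) (q : Polynomial K) :
    map φ (Polynomial.aeval (X m : MvPolynomial (Fin n) K) q) =
      Polynomial.aeval (X m : MvPolynomial (Fin n) L) (q.map φ) := by
  rw [Polynomial.map_aeval_eq_aeval_map (ψ := map φ) (φ := φ) (by ext k; simp) q (X m), map_X]

/-- Extension of scalars on a `Σ∧` form: `(a + ∑_m p_m(x_m))^φ = φ a + ∑_m p_m^φ(x_m)`.
[cite: DuttaDwivediSaxena2022, Def. 2.1 (full version p0016 L416–419)] -/
theorem map_wedgeForm {L : Type*} [Field L] (φ : K →+* L) (a : K) (p : Fin n → Polynomial K) :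
    map φ (wedgeForm a p) = wedgeForm (φ a) (fun m => (p m).map φ) := by
  simp only [wedgeForm_eq, map_add, map_sum, map_C, map_aeval_X]

/-- **Extension of scalars** preserves the normal form with the same budgets (the class read over a
larger field, as in Def. 2.1's `𝒞_{𝔽(ε)}`; used for the base change of the input of Thm. 5.1).
[cite: DuttaDwivediSaxena2022, Def. 2.1 (full version p0016 L416–419)] -/
theorem swswClass_map {L : Type*} [Field L] (φ : K →+* L) {t e δ : ℕ} {f : MvPolynomial (Fin n) K}
    (hf : f ∈ swswClass K n t e δ) : map φ f ∈ swswClass L n t e δ := by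
  obtain ⟨c, a, p, ex, hex, hp, rfl⟩ := hf
  refine ⟨fun i => φ (c i), fun i => φ (a i), fun i m => (p i m).map φ, ex, hex,
    fun i m => Polynomial.natDegree_map_le.trans (hp i m), ?_⟩
  simp only [map_sum, map_mul, map_pow, map_C, map_wedgeForm]

/-- **`Σ∧Σ∧ ⊆ \overline{Σ∧Σ∧}`**: an exact member over `F` is a border member (approximate it by
itself, read over `F(ε)`; the tree's `border` and `MS2021.IsEpsApprox`).
[cite: DuttaDwivediSaxena2022, Def. 2.1 (full version p0016 L416–419)] -/
theorem mem_border_swswClass {F : Type*} [Field F] {t e δ : ℕ} {f : MvPolynomial (Fin n) F}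
    (hf : f ∈ swswClass F n t e δ) : f ∈ border (swswClass (RatFunc F) n t e δ) :=
  ⟨map (algebraMap F (RatFunc F)) f, swswClass_map _ hf, isEpsApprox_map_algebraMap f⟩

end Scalars

end DDS2021

end Literature.Computability.AlgebraicComplexity
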